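import Summits.QuantumAdvantage.QuantumAdvantage.Theorems.MobiusLadderDigitPolyUniformityShiftInvariant
import Summits.QuantumAdvantage.QuantumAdvantage.Theorems.MobiusLadderDigitPolyUniformitySymmetricShift

/-!
# Crux `DigitPolyUniformity` (stmt-QuantumAdvantage-1392), line `Sketch` (LAR composition):
# symmetric digital phases of ANY degree correlate at most `1/3 + o(1)` with `λ`, unconditionally

Corollary of the two wave-3 stubs of seat c4 (both landed):
`liouville_corr_le_of_shiftInvariant` (`Theorems/…ShiftInvariant`: every shift-invariant digital phase
has `3·|Σ_{N<2ⁿ} λ χ_P| ≤ 2ⁿ + 1`) and `eval_digits_double_of_isSymmetric` (`Theorems/…SymmetricShift`: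
symmetric polynomials are shift-invariant below `2^{n−1}`).

For every `n` and every SYMMETRIC `P ∈ 𝔽₂[x_0..x_{n−1}]` (`MvPolynomial.IsSymmetric`) — of any
degree, so in particular every digit-sum weight `g(s₂(N) mod m)` for any modulus `m = m(n)` and every
elementary symmetric polynomial `e_k`, `k = k(n)` —

  `3 · |Σ_{N<2ⁿ} λ(N) (−1)^{P(bits N)}| ≤ 2ⁿ + 1`   (`liouville_corr_le_of_isSymmetric`).

Calibration value for the crux: this is the UNCONDITIONAL, UNIFORM constant-level bound (correlation
`≤ 1/3 + 2^{−n}/3`) for the growing-parameter symmetric families, which are open at level `o(1)` even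
modulo Müllner's theorem (seat c3's dossier `Cruxes/DigitPolyUniformity/Lines/SketchLAR-c3-automatic.md`
settles only FIXED `m`, `k` conditionally); it is exactly what complete multiplicativity at the prime `2`
gives, and `1/3` is sharp for the class of all shift-invariant phases (choose the sign freely on each
`×2`-chain of odd length). No named facts.
-/

namespace Summit.QuantumAdvantage.DigitPolyUniformity.SketchLAR

open Finset

/-- **Symmetric digital phases correlate at most `1/3 + o(1)` with the Liouville function,
unconditionally and uniformly in the degree.** For every symmetric `P ∈ 𝔽₂[x_0..x_{n−1}]`,
`3·|Σ_{N<2ⁿ} λ(N) χ_P(N)| ≤ 2ⁿ + 1`. Proof: symmetric polynomials are invariant under the digit shift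
`N ↦ 2N` below `2^{n−1}` (`eval_digits_double_of_isSymmetric`), and shift-invariant phases obey the
`×2`-chain bound (`liouville_corr_le_of_shiftInvariant`). [folklore] -/
theorem liouville_corr_le_of_isSymmetric :
    ∀ {n : ℕ} (P : MvPolynomial (Fin n) (ZMod 2)), P.IsSymmetric →
      3 * |∑ N ∈ Finset.range (2 ^ n), ((ArithmeticFunction.liouville N : ℤ) : ℝ) *
          (if MvPolynomial.eval (fun i : Fin n => if Nat.testBit N i then (1 : ZMod 2) else 0) P = 1
            then (-1 : ℝ) else 1)| ≤ (2 : ℝ) ^ n + 1 :=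
  fun P hP => liouville_corr_le_of_shiftInvariant P (eval_digits_double_of_isSymmetric P hP)

end Summit.QuantumAdvantage.DigitPolyUniformity.SketchLAR
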